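import Summits.QuantumFields.BalabanUV.T4Continuum.Support.NE7BalabanSoftOperatorMass
import Summits.QuantumFields.BalabanUV.T4Continuum.Support.NE3EnergyWeightedShapes
import Summits.QuantumFields.BalabanUV.T4Continuum.Support.NE3EnergyHessContTwoTerm
import HarnessLib

/-!
# NE7SoftOperatorSlicePositivity — THE DIAGONAL THIRD OF (P_a): on any set `T` of skew periodic fields where row NE3's WEIGHTED TANGENT COERCIVITY holds
# (`c·(curlSq + M⁻²dirSq)(Y) ≤ hess W Y Y`, `c > 0` — a class theorem of row NE3 on its slice `frameFreeBlockLandauW` via `SlicePoincare`), Bałaban's soft operator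
# `softSymOpKa a` (`a ≥ 0`) is STRICTLY POSITIVE: `⟪b, softSymOpKa a b⟫ ≥ c·M⁻²·dirSq (extF b) > 0` for `b ≠ 0` with `extF b ∈ T` — the two gauge∕mass squares are simply dropped
# (file 135 of the curved (APE), F206)

Cell `pub-balaban`, rung (B)+1 sub-cell t4, lineage `b2b-balaban-t4-ne7-p1` (CRUX PROVER NE7 #1 = OWNER of row NE7), generation 85; memo
`t4/b2b-balaban-t4-ne7-p1-g85/LAGRANGE-CARRIER.md` §10.  Over F202 `NE7BalabanSoftOperatorMass.inner_softSymOpKa_self`, row NE3's `NE3EnergyWeightedShapes.WeightedTangentCoercive`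
∕ `energyNormW` and `NE3EnergyHessContTwoTerm.curlSq_nonneg` BY NAME.
WHY.  After F204 the END's positivity letter is (P_a) for the CONCRETE `softSymOpKa a`; memo §10 decomposes its proof into a slice part, a pure-gauge part, a lift part and
cross terms.  The SLICE part is row NE3's tangent coercivity verbatim (the window `perWin d P = periodBox P ×ˢ univ` is row NE3's `F ×ˢ univ`); THIS file records it, and the
elementary fact that a non-zero skew torus 1-form has `dirSq (extF b) (periodBox) > 0`.
WHAT ([folklore]; 0 def, 0 sorry).  §1 `dirSq_extF_pos` (`b ≠ 0 ⟹ 0 < dirSq (extF b) (periodBox P)`); §2 **`inner_softSymOpKa_self_ge_of_coercive`** (`c·M⁻²·dirSq(extF b) ≤ ⟪b, S_a b⟫` for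
`extF b ∈ T`), **`softSymOpKa_pos_on_slice`** (`0 < ⟪b, S_a b⟫` for `b ≠ 0`, `extF b ∈ T`).
HONEST FRAMING (page 1): three inequalities; the coercivity on `T` is a DISPLAYED HYPOTHESIS here (row NE3 proves it for its own slice in the class); (P_a) on ALL skew forms is NOT
proved (the gauge and lift parts and the cross terms remain, memo §10); (KL-B) at curved `W` NOT proved; (APE) on curved data NOT proved; NOT ONE-STEP, NOT NE7; spine 0∕9; finite T⁴
rung (B)+1 — NOT infinite volume, NOT mass gap, NOT `BetaPertH`, NOT Clay.  Continuum YM on T⁴ ⇐ BetaPertH ∧ nine spine estimates (0/9 proved); BetaPertH ⇐ (D1) ∧ (D4) ∧ CAP+tail;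
G-an2-4 gates asym, D1 and NE2/3/4.
-/

set_option autoImplicit false

open scoped BigOperators InnerProductSpace Matrix Matrix.Norms.L2Operator
open Finset

namespace Summit.QuantumFields.BalabanUV.T4Continuum.NE7SoftOperatorSlicePositivity

open Literature.MathematicalPhysics.QuantumFieldTheory.Balaban1983to89
open B7Prop1Explicit B7Prop2Explicit UnitaryModel
open T4AveragingDeficitWall (IsUnitaryCfg IsSkewDir SmallField curlSq dirSq)
open T4AveragingDeficitWallBoundary (periodBox IsPeriodicCfg)
open AveragingDeficitMultiLevelPrep (LevelSmall)
open MinimalActionLevels (perWin)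
open NE3HessForm (hess)
open NE3HilbertSchmidtTorus
open NE3EnergyWeightedShapes (WeightedTangentCoercive energyNormW)
open NE3EnergyHessContTwoTerm (curlSq_nonneg dirSq_nonneg)
open NE7BalabanSoftOperator
open NE7BalabanSoftOperatorMass

noncomputable section

variable {d : ℕ} {n : Type*} [Fintype n] [DecidableEq n]

/-! ## §1 A non-zero skew torus 1-form has positive `dirSq` over one period -/

/-- **`b ≠ 0 ⟹ 0 < dirSq (extF b) (periodBox P)`** (a torus 1-form vanishing on every representative bond is zero). [folklore] -/
theorem dirSq_extF_pos {P : ℕ} [NeZero P] {b : skewForms d n P} (hb : b ≠ 0) : 0 < dirSq (extF P (b : Form d n P)) (periodBox (d := d) P) := by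
  by_contra hle
  have h0 : dirSq (extF P (b : Form d n P)) (periodBox (d := d) P) = 0 := le_antisymm (not_lt.mp hle) (dirSq_nonneg _ _)
  apply hb
  -- every bond value on the representatives vanishes
  have hzero : ∀ x ∈ periodBox (d := d) P, ∀ κ : Fin d, extF P (b : Form d n P) x κ = 0 := by
    intro x hx κ
    have h1 := (Finset.sum_eq_zero_iff_of_nonneg (fun y _ => Finset.sum_nonneg fun κ _ => sq_nonneg _)).mp h0 x hx
    have h2 := (Finset.sum_eq_zero_iff_of_nonneg (fun κ _ => sq_nonneg _)).mp h1 κ (Finset.mem_univ _)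
    exact norm_eq_zero.mp (pow_eq_zero_iff (n := 2) (by norm_num) |>.mp h2)
  -- hence the form is zero: its norm over one period vanishes
  have hnorm : ‖(b : Form d n P)‖ ^ 2 = 0 := by
    rw [← resF_extF P (b : Form d n P), norm_sq_resF]
    refine Finset.sum_eq_zero fun x hx => Finset.sum_eq_zero fun κ _ => ?_
    rw [hzero x hx κ]
    simp [MatrixNorms.nhsNormSq]
  exact Subtype.ext (norm_eq_zero.mp (pow_eq_zero_iff (n := 2) (by norm_num) |>.mp hnorm))

/-! ## §2 Positivity on the coercive set -/

section Carrier

variable [Nonempty n] {L N : ℕ} [NeZero N] (hL : 1 ≤ L) (j : ℕ) [NeZero (N * L ^ (j + 1))]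
  {W : Site d → Fin d → (Matrix n n ℂ)ˣ} {x : ℝ} (hWu : IsUnitaryCfg W) (hx : 0 ≤ x) (hs : LevelSmall d L j x) (hWx : SmallField W x)

/-- **THE SLICE PART OF (P_a)**: if row NE3's weighted tangent coercivity holds on `T` with constant `c` (`c·(curlSq + M⁻²dirSq) ≤ hess`, `M = L^{j+1}`), then for every skew torus 1-form
`b` with `extF b ∈ T` and every `a ≥ 0`: `c·M⁻²·dirSq (extF b) ≤ ⟪b, softSymOpKa a b⟫` (the gauge and mass squares are non-negative and dropped). [folklore] -/
theorem inner_softSymOpKa_self_ge_of_coercive {T : Set (Site d → Fin d → Matrix n n ℂ)} {c : ℝ} (hc : 0 ≤ c)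
    (hT : WeightedTangentCoercive L (j + 1) W T c (periodBox (d := d) (N * L ^ (j + 1)))) {a : ℝ} (ha : 0 ≤ a)
    (b : skewForms d n (N * L ^ (j + 1))) (hb : extF (N * L ^ (j + 1)) (b : Form d n (N * L ^ (j + 1))) ∈ T) :
    c * ((((L : ℝ) ^ (j + 1))⁻¹) ^ 2 * dirSq (extF (N * L ^ (j + 1)) (b : Form d n (N * L ^ (j + 1)))) (periodBox (d := d) (N * L ^ (j + 1))))
      ≤ ⟪b, softSymOpKa (N := N) hL j hWu hx hs hWx a b⟫_ℝ := by
  have hcoer := hT _ hb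
  have hE : energyNormW L (j + 1) W (extF (N * L ^ (j + 1)) (b : Form d n (N * L ^ (j + 1)))) (periodBox (d := d) (N * L ^ (j + 1))) ^ 2
      = curlSq W (extF (N * L ^ (j + 1)) (b : Form d n (N * L ^ (j + 1)))) (periodBox (d := d) (N * L ^ (j + 1)))
        + (((L : ℝ) ^ (j + 1))⁻¹) ^ 2 * dirSq (extF (N * L ^ (j + 1)) (b : Form d n (N * L ^ (j + 1)))) (periodBox (d := d) (N * L ^ (j + 1))) := by
    unfold NE3EnergyWeightedShapes.energyNormW
    rw [Real.sq_sqrt (add_nonneg (curlSq_nonneg _ _ _) (mul_nonneg (sq_nonneg _) (dirSq_nonneg _ _)))]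
  rw [hE] at hcoer
  rw [inner_softSymOpKa_self]
  have h1 : 0 ≤ curlSq W (extF (N * L ^ (j + 1)) (b : Form d n (N * L ^ (j + 1)))) (periodBox (d := d) (N * L ^ (j + 1))) := curlSq_nonneg _ _ _
  have h2 : 0 ≤ ⟪landauProjK L N (j + 1) W
      ((LinearMap.adjoint (𝕜 := ℝ) (E := skewSecs d n (N * L ^ (j + 1))) (F := skewForms d n (N * L ^ (j + 1))) (gradOpK hWu (N * L ^ (j + 1)))
        : skewForms d n (N * L ^ (j + 1)) →ₗ[ℝ] skewSecs d n (N * L ^ (j + 1))) b),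
      landauProjK L N (j + 1) W
      ((LinearMap.adjoint (𝕜 := ℝ) (E := skewSecs d n (N * L ^ (j + 1))) (F := skewForms d n (N * L ^ (j + 1))) (gradOpK hWu (N * L ^ (j + 1)))
        : skewForms d n (N * L ^ (j + 1)) →ₗ[ℝ] skewSecs d n (N * L ^ (j + 1))) b)⟫_ℝ := real_inner_self_nonneg
  have h3 : 0 ≤ ⟪qbarOpK (N := N) hL j hWu hx hs hWx b, qbarOpK (N := N) hL j hWu hx hs hWx b⟫_ℝ := real_inner_self_nonneg
  have hwin : hess W (extF (N * L ^ (j + 1)) (b : Form d n (N * L ^ (j + 1)))) (extF (N * L ^ (j + 1)) (b : Form d n (N * L ^ (j + 1))))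
      (periodBox (d := d) (N * L ^ (j + 1)) ×ˢ Finset.univ)
      = hess W (extF (N * L ^ (j + 1)) (b : Form d n (N * L ^ (j + 1)))) (extF (N * L ^ (j + 1)) (b : Form d n (N * L ^ (j + 1)))) (perWin d (N * L ^ (j + 1))) := rfl
  rw [hwin] at hcoer
  nlinarith [mul_nonneg hc h1, mul_nonneg ha h3]

/-- **POSITIVITY ON THE COERCIVE SET**: with `c > 0`, `a ≥ 0`, every non-zero skew torus 1-form `b` with `extF b ∈ T` has `0 < ⟪b, softSymOpKa a b⟫`. [folklore] -/
theorem softSymOpKa_pos_on_slice {T : Set (Site d → Fin d → Matrix n n ℂ)} {c : ℝ} (hc : 0 < c)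
    (hT : WeightedTangentCoercive L (j + 1) W T c (periodBox (d := d) (N * L ^ (j + 1)))) {a : ℝ} (ha : 0 ≤ a)
    (b : skewForms d n (N * L ^ (j + 1))) (hb0 : b ≠ 0) (hb : extF (N * L ^ (j + 1)) (b : Form d n (N * L ^ (j + 1))) ∈ T) :
    0 < ⟪b, softSymOpKa (N := N) hL j hWu hx hs hWx a b⟫_ℝ := by
  have hL0 : (0 : ℝ) < (L : ℝ) ^ (j + 1) := by
    have : (0 : ℝ) < L := by exact_mod_cast (show 0 < L by omega)
    positivity
  have hpos : 0 < c * ((((L : ℝ) ^ (j + 1))⁻¹) ^ 2 * dirSq (extF (N * L ^ (j + 1)) (b : Form d n (N * L ^ (j + 1)))) (periodBox (d := d) (N * L ^ (j + 1)))) :=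
    mul_pos hc (mul_pos (by positivity) (dirSq_extF_pos hb0))
  exact lt_of_lt_of_le hpos (inner_softSymOpKa_self_ge_of_coercive hL j hWu hx hs hWx hc.le hT ha b hb)

end Carrier

end

end Summit.QuantumFields.BalabanUV.T4Continuum.NE7SoftOperatorSlicePositivity
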